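import Summits.ABC.ABC.Theorems.ModerateWindowCount.Negative.Window
import Summits.ABC.ABC.Theorems.ModerateWindowCount.Negative.NoMinFamily

/-!
# `ModerateWindowCount` (stmt-ABC-1973) — negative-side lemmas VII: **minimality is load-bearing**

Standing-adversary (cdisprove) output. `moderateWindowCount_false_without_minimality`: with the clause
"minimal at every place" removed from the counted set, the statement of the crux is FALSE — instance
`σ = 7`, for EVERY `κ ∈ (3,7)`, `δ < (7−κ)/8`, `C`. Unlike the CM exclusions (`c₄ ≠ 0`, `c₆ ≠ 0`, which the
`∃ κ` of the target escapes by taking `κ > 5`), non-minimal integral rescalings `sc b k` of ONE curve multiply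
`M⁺` by `k¹²` at fixed conductor, so every curve acquires members at every ratio above its own: at
`X = 368 B²` the pairs `b` prime in `(B^{1−η}, B]`, `k ∈ [⌈e^{ℓ₁}⌉, ⌊e^{ℓ₂}⌋]` (`η = (7−κ)/14`,
`ℓ₂ − ℓ₁ = ((7−κ) log B − κ log 368)/12`) are members of `windowNoMin κ 7 X` and number
`≥ B e^{ℓ₂}/(8 log B) ≫ B^{1+2(1−η)/3}/log B`, against `C X^δ ≤ 20 C B^{2δ}`, `2δ < 1` (`noMin_core` +
Chebyshev + eventual largeness). Refuter seat refuter-cdisprove-stmt-ABC-1973-0, 2026-08-16.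
-/

namespace Summit.ABC.ABC.Theorems.ModerateWindowCount.Negative

open Summit.ABC.ABC.Theses.TwistAmplification WeierstrassCurve IsDedekindDomain
open Summit.ABC.ABC.Theorems.SomeWindowSaving.Negative

noncomputable section

/-! ### 6.2 The window without minimality, membership of `sc b k`, and the count at `σ = 7` -/

/-- The crux window with the clause "minimal at every place" removed. [folklore] -/
def windowNoMin (κ σ X : ℝ) : Set (WeierstrassCurve ℤ) :=
  {W₀ : WeierstrassCurve ℤ | (W₀.baseChange ℚ).IsElliptic ∧
    (W₀.a₁ = 0 ∨ W₀.a₁ = 1) ∧ (W₀.a₃ = 0 ∨ W₀.a₃ = 1) ∧ (W₀.a₂ = -1 ∨ W₀.a₂ = 0 ∨ W₀.a₂ = 1) ∧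
    W₀.c₄ ≠ 0 ∧ W₀.c₆ ≠ 0 ∧
    (((W₀.baseChange ℚ).conductorNorm ℤ : ℕ) : ℝ) ≤ X ∧
    (((W₀.baseChange ℚ).conductorNorm ℤ : ℕ) : ℝ) ^ κ ≤ ((max |W₀.Δ| (|W₀.c₄| ^ 3) : ℤ) : ℝ) ∧
    ((max |W₀.Δ| (|W₀.c₄| ^ 3) : ℤ) : ℝ) ≤ (((W₀.baseChange ℚ).conductorNorm ℤ : ℕ) : ℝ) ^ σ}

/-- `ModerateWindowCount` with minimality dropped. -/
def ModerateWindowCountWithoutMinimality : Prop :=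
  ∀ σ : ℝ, 6 < σ → ∃ κ δ C : ℝ, 3 < κ ∧ κ < σ ∧ δ < (σ - κ) / (2 * σ - 6) ∧
    ∀ X : ℝ, 1 ≤ X → (Set.ncard (windowNoMin κ σ X) : ℝ) ≤ C * X ^ δ

/-- The window without minimality is still finite (same engine: reducedness and `M⁺ ≤ max 1 X^σ`). [folklore] -/
theorem windowNoMin_finite (κ σ X : ℝ) : (windowNoMin κ σ X).Finite := by
  refine (reducedCap_finite (⌈max (1 : ℝ) (X ^ σ)⌉₊ : ℕ)).subset ?_
  intro W hW
  obtain ⟨hE, h₁, h₃, h₂, -, -, hNX, -, hM⟩ := hW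
  refine ⟨h₁, h₃, h₂, ?_⟩
  haveI := hE
  have hN1 : (1 : ℝ) ≤ (((W.baseChange ℚ).conductorNorm ℤ : ℕ) : ℝ) := by
    exact_mod_cast conductorNorm_pos_holds (W.baseChange ℚ)
  have hM' : ((max |W.Δ| (|W.c₄| ^ 3) : ℤ) : ℝ) ≤ max 1 (X ^ σ) := by
    refine hM.trans ?_
    rcases le_or_gt 0 σ with hσ | hσ
    · exact le_max_of_le_right (Real.rpow_le_rpow (by linarith) hNX hσ)
    · exact le_max_of_le_left (Real.rpow_le_one_of_one_le_of_nonpos hN1 hσ.le)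
  have : ((max |W.Δ| (|W.c₄| ^ 3) : ℤ) : ℝ) ≤ ((⌈max (1 : ℝ) (X ^ σ)⌉₊ : ℕ) : ℝ) :=
    hM'.trans (Nat.le_ceil _)
  exact_mod_cast this

/-- **Membership of `sc b k` in `windowNoMin κ 7 X`** from the two ratio conditions in logarithmic
form (`b² ≤ N ≤ 368 b²`, `M⁺ = 110592 b⁶ k¹²`). [folklore] -/
theorem sc_mem_windowNoMin {κ : ℝ} (hκ : 0 ≤ κ) {b k : ℕ} (hb : b.Prime) (h29 : 29 ≤ b) (hk : k ≠ 0)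
    {X : ℝ} (hX : 368 * (b : ℝ) ^ 2 ≤ X)
    (hlo : κ * Real.log (368 * (b : ℝ) ^ 2) ≤ Real.log (110592 * (b : ℝ) ^ 6 * (k : ℝ) ^ 12))
    (hhi : Real.log (110592 * (b : ℝ) ^ 6 * (k : ℝ) ^ 12) ≤ 7 * Real.log ((b : ℝ) ^ 2)) :
    sc b k ∈ windowNoMin κ 7 X := by
  haveI : NeZero b := ⟨hb.ne_zero⟩
  haveI : NeZero k := ⟨hk⟩
  obtain ⟨hNlo, hNhi⟩ := sc_conductor_bounds hb h29 hk
  set N : ℝ := ((((sc b k).baseChange ℚ).conductorNorm ℤ : ℕ) : ℝ) with hNdef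
  have hb0 : (0 : ℝ) < b := by exact_mod_cast hb.pos
  have hk0 : (0 : ℝ) < k := by exact_mod_cast Nat.pos_of_ne_zero hk
  have hb2 : (0 : ℝ) < (b : ℝ) ^ 2 := by positivity
  have hN0 : 0 < N := lt_of_lt_of_le hb2 hNlo
  have hM : (((max |(sc b k).Δ| (|(sc b k).c₄| ^ 3) : ℤ) : ℝ)) = 110592 * (b : ℝ) ^ 6 * (k : ℝ) ^ 12 := by
    rw [sc_maxInv]; push_cast; ring
  have hM0 : (0 : ℝ) < 110592 * (b : ℝ) ^ 6 * (k : ℝ) ^ 12 := by positivity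
  refine ⟨sc_isElliptic b k, Or.inl rfl, Or.inl rfl, Or.inr (Or.inl rfl), ?_, ?_, hNhi.trans hX, ?_, ?_⟩
  · rw [sc_c₄]; positivity
  · rw [sc_c₆]
    have : (0 : ℤ) < 864 * (b : ℤ) ^ 3 * (k : ℤ) ^ 6 := by
      have : (0 : ℤ) < b := by exact_mod_cast hb.pos
      have : (0 : ℤ) < k := by exact_mod_cast Nat.pos_of_ne_zero hk
      positivity
    linarith
  · rw [hM, Real.rpow_def_of_pos hN0, ← Real.exp_log hM0]
    apply Real.exp_le_exp.mpr
    have h1 : Real.log N ≤ Real.log (368 * (b : ℝ) ^ 2) := Real.log_le_log hN0 hNhi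
    nlinarith [mul_le_mul_of_nonneg_left h1 hκ]
  · rw [hM, Real.rpow_def_of_pos hN0, ← Real.exp_log hM0]
    apply Real.exp_le_exp.mpr
    have h1 : Real.log ((b : ℝ) ^ 2) ≤ Real.log N := Real.log_le_log hb2 hNlo
    linarith

set_option maxHeartbeats 800000 in
/-- **Core of the no-minimality count** at `σ = 7`: given the law with `δ < (7−κ)/8`, `1 ≤ C`, the
Chebyshev threshold and a large integer `B` (`x = B`, `η = (7−κ)/14`, `L = log x`), contradiction. [folklore] -/
theorem noMin_core {κ δ C : ℝ} (hκ3 : 3 < κ) (hκ7 : κ < 7) (hδ : δ < (7 - κ) / 8)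
    (hC1 : 1 ≤ C) (hlaw : ∀ X : ℝ, 1 ≤ X → (Set.ncard (windowNoMin κ 7 X) : ℝ) ≤ C * X ^ δ)
    {T₀ : ℕ} (hT₀ : ∀ A T : ℕ, T₀ ≤ T → 6 * A + 1 ≤ T →
      (T : ℝ) / 4 ≤ (primesIoc A T).card * Real.log T)
    {B : ℕ} (hBT : T₀ ≤ B)
    (h29 : (29 : ℝ) ≤ (B : ℝ) ^ (1 - (7 - κ) / 14))
    (hA : 6 * (B : ℝ) ^ (1 - (7 - κ) / 14) + 7 ≤ B)
    (hℓ : κ * Real.log 368 + 12 * Real.log 4 ≤ (7 - κ) * Real.log B)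
    (hℓ₁ : Real.log 110592 ≤ (2 * κ - 6 + 6 * ((7 - κ) / 14)) * Real.log B)
    (hmain : 500 * C * Real.log B ≤ (B : ℝ) ^ (2 * (1 - (7 - κ) / 14) / 3 + 1 - 2 * δ)) : False := by
  set η : ℝ := (7 - κ) / 14 with hηdef
  have hη0 : 0 < η := by rw [hηdef]; linarith
  have hη1 : η < 1 := by rw [hηdef]; linarith
  have hδ2 : δ < 1 / 2 := by have : (7 - κ) / 8 < 1 / 2 := by rw [div_lt_iff₀ (by norm_num)]; linarith
                             linarith
  have hC0 : 0 < C := by linarith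
  set x : ℝ := (B : ℝ) with hxdef
  have hx29 : (29 : ℝ) ≤ x := by
    have h1 : (1 : ℝ) ≤ x := by
      by_contra h
      push Not at h
      have : x ^ (1 - η) ≤ 1 := Real.rpow_le_one (Nat.cast_nonneg _) h.le (by linarith)
      linarith
    calc (29 : ℝ) ≤ x ^ (1 - η) := h29
      _ ≤ x ^ (1 : ℝ) := Real.rpow_le_rpow_of_exponent_le h1 (by linarith)
      _ = x := Real.rpow_one x
  have hx0 : 0 < x := by linarith
  set Lb : ℝ := Real.log x with hLbdef
  have hLb0 : 0 < Lb := Real.log_pos (by linarith)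
  have hxη : x ^ (1 - η) = Real.exp ((1 - η) * Lb) := by
    rw [Real.rpow_def_of_pos hx0, hLbdef, mul_comm]
  -- `A` and the prime supply
  set A : ℕ := ⌈x ^ (1 - η)⌉₊ with hAdef
  have hAlo : x ^ (1 - η) ≤ A := Nat.le_ceil _
  have hAhi : (A : ℝ) < x ^ (1 - η) + 1 := Nat.ceil_lt_add_one (Real.rpow_nonneg hx0.le _)
  have hA29 : 29 ≤ A := by
    have : (29 : ℝ) ≤ A := h29.trans hAlo
    exact_mod_cast this
  have hAB : 6 * A + 1 ≤ B := by
    have : (6 * A + 1 : ℝ) ≤ x := by linarith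
    rw [hxdef] at this
    exact_mod_cast this
  have hsup := hT₀ A B hBT hAB
  -- the `k`-range
  set ℓ₁ : ℝ := (κ * Real.log 368 + (2 * κ - 6 + 6 * η) * Lb - Real.log 110592) / 12 with hℓ₁def
  set ℓ₂ : ℝ := (8 * (1 - η) * Lb - Real.log 110592) / 12 with hℓ₂def
  have hℓ₁0 : 0 ≤ ℓ₁ := by
    have h1 : 0 ≤ κ * Real.log 368 := mul_nonneg (by linarith) (Real.log_nonneg (by norm_num))
    rw [hℓ₁def]
    apply div_nonneg _ (by norm_num)
    linarith
  have hℓ21 : ℓ₁ + Real.log 4 ≤ ℓ₂ := by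
    rw [hℓ₁def, hℓ₂def]
    have e : 8 * (1 - η) - (2 * κ - 6 + 6 * η) = 7 - κ := by rw [hηdef]; ring
    have : (8 * (1 - η) * Lb - Real.log 110592) - (κ * Real.log 368 + (2 * κ - 6 + 6 * η) * Lb -
        Real.log 110592) = (7 - κ) * Lb - κ * Real.log 368 := by rw [← e]; ring
    linarith
  set klo : ℕ := ⌈Real.exp ℓ₁⌉₊ with hklodef
  set khi : ℕ := ⌊Real.exp ℓ₂⌋₊ with hkhidef
  have hklo1 : 1 ≤ klo := by
    have : (1 : ℝ) ≤ klo := le_trans (by have := Real.one_le_exp hℓ₁0; linarith) (Nat.le_ceil _)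
    exact_mod_cast this
  have hklo_hi : (klo : ℝ) < Real.exp ℓ₁ + 1 := Nat.ceil_lt_add_one (Real.exp_pos _).le
  have hkhi_lo : Real.exp ℓ₂ - 1 < khi := by
    have := Nat.lt_floor_add_one (Real.exp ℓ₂); linarith
  have hkhi_hi : (khi : ℝ) ≤ Real.exp ℓ₂ := Nat.floor_le (Real.exp_pos _).le
  have hexp4 : Real.exp ℓ₂ ≥ 4 * Real.exp ℓ₁ := by
    have := Real.exp_le_exp.mpr hℓ21
    rwa [Real.exp_add, Real.exp_log (by norm_num), mul_comm] at this
  have he1 : 1 ≤ Real.exp ℓ₁ := Real.one_le_exp hℓ₁0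
  set Ks : Finset ℕ := Finset.Icc klo khi with hKsdef
  have hKs_card : Real.exp ℓ₂ / 2 ≤ (Ks.card : ℝ) := by
    have h1 : (Ks.card : ℝ) = (khi : ℝ) + 1 - klo := by
      rw [hKsdef, Nat.card_Icc]
      have : klo ≤ khi + 1 := by
        have : (klo : ℝ) ≤ khi + 1 := by linarith
        exact_mod_cast this
      push_cast [Nat.cast_sub this]; ring
    rw [h1]; linarith
  -- the pairs and their images
  classical
  set S : Finset (ℕ × ℕ) := (primesIoc A B) ×ˢ Ks with hSdef
  set X : ℝ := 368 * x ^ 2 with hXdef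
  have hX1 : 1 ≤ X := by rw [hXdef]; nlinarith
  have hmemS : ∀ q ∈ S, q.1.Prime ∧ 29 ≤ q.1 ∧ (A : ℝ) < q.1 ∧ (q.1 : ℝ) ≤ x ∧ q.2 ≠ 0 ∧
      ℓ₁ ≤ Real.log q.2 ∧ Real.log q.2 ≤ ℓ₂ := by
    intro q hq
    rw [hSdef, Finset.mem_product, primesIoc, Finset.mem_filter, Finset.mem_Ioc, hKsdef,
      Finset.mem_Icc] at hq
    obtain ⟨⟨⟨hAq, hqB⟩, hqp⟩, hk1, hk2⟩ := hq
    have hq0 : q.2 ≠ 0 := by omega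
    have hq0R : (0 : ℝ) < q.2 := by exact_mod_cast Nat.pos_of_ne_zero hq0
    refine ⟨hqp, by omega, by exact_mod_cast hAq, by rw [hxdef]; exact_mod_cast hqB, hq0, ?_, ?_⟩
    · have h1 : Real.exp ℓ₁ ≤ q.2 := le_trans (Nat.le_ceil _) (by exact_mod_cast hk1)
      have := Real.log_le_log (Real.exp_pos _) h1
      rwa [Real.log_exp] at this
    · have h1 : (q.2 : ℝ) ≤ Real.exp ℓ₂ := le_trans (by exact_mod_cast hk2) hkhi_hi
      have := Real.log_le_log hq0R h1
      rwa [Real.log_exp] at this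
  have hmem : ∀ q ∈ S, sc q.1 q.2 ∈ windowNoMin κ 7 X := by
    intro q hq
    obtain ⟨hqp, hq29, hAq, hqx, hq0, hk1, hk2⟩ := hmemS q hq
    have hb0 : (0 : ℝ) < q.1 := by exact_mod_cast hqp.pos
    have hk0 : (0 : ℝ) < q.2 := by exact_mod_cast Nat.pos_of_ne_zero hq0
    set ℓb : ℝ := Real.log q.1 with hℓbdef
    set ℓk : ℝ := Real.log q.2 with hℓkdef
    have hℓb_hi : ℓb ≤ Lb := Real.log_le_log hb0 hqx
    have hℓb_lo : (1 - η) * Lb ≤ ℓb := by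
      have h1 : x ^ (1 - η) < q.1 := lt_of_le_of_lt hAlo hAq
      have h2 := Real.log_lt_log (Real.rpow_pos_of_pos hx0 _) h1
      rw [hxη, Real.log_exp] at h2
      exact h2.le
    have hlog368 : Real.log (368 * (q.1 : ℝ) ^ 2) = Real.log 368 + 2 * ℓb := by
      rw [Real.log_mul (by norm_num) (by positivity), Real.log_pow]; push_cast; ring
    have hlogM : Real.log (110592 * (q.1 : ℝ) ^ 6 * (q.2 : ℝ) ^ 12) =
        Real.log 110592 + 6 * ℓb + 12 * ℓk := by
      rw [Real.log_mul (by positivity) (by positivity), Real.log_mul (by norm_num) (by positivity),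
        Real.log_pow, Real.log_pow]; push_cast; ring
    have hlogb2 : Real.log ((q.1 : ℝ) ^ 2) = 2 * ℓb := by rw [Real.log_pow]; push_cast; ring
    refine sc_mem_windowNoMin (by linarith) hqp hq29 hq0 ?_ ?_ ?_
    · rw [hXdef]; exact mul_le_mul_of_nonneg_left (pow_le_pow_left₀ hb0.le hqx 2) (by norm_num)
    · rw [hlog368, hlogM]
      have e : 12 * ℓ₁ = κ * Real.log 368 + (2 * κ - 6 + 6 * η) * Lb - Real.log 110592 := by
        rw [hℓ₁def]; ring
      have h2 : κ * (2 * ℓb) ≤ κ * (2 * Lb) := mul_le_mul_of_nonneg_left (by linarith) (by linarith)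
      linarith [hℓb_lo, hk1, e, h2, hη0]
    · rw [hlogM, hlogb2]
      have e : 12 * ℓ₂ = 8 * (1 - η) * Lb - Real.log 110592 := by rw [hℓ₂def]; ring
      linarith [hℓb_lo, hk2, e]
  have hinj : Set.InjOn (fun q : ℕ × ℕ => sc q.1 q.2) ↑S := by
    intro q hq q' hq' h
    obtain ⟨hqp, -, -, -, hq0, -⟩ := hmemS q hq
    obtain ⟨hqp', -, -, -, hq0', -⟩ := hmemS q' hq'
    obtain ⟨h1, h2⟩ := sc_injective hqp hqp' hq0 hq0' h
    exact Prod.ext h1 h2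
  have hcount : (S.card : ℝ) ≤ (Set.ncard (windowNoMin κ 7 X) : ℝ) := by
    have hsub : (↑(S.image fun q : ℕ × ℕ => sc q.1 q.2) : Set (WeierstrassCurve ℤ)) ⊆ windowNoMin κ 7 X := by
      intro W hW
      rw [Finset.coe_image] at hW
      obtain ⟨q, hq, rfl⟩ := hW
      exact hmem q hq
    have h1 : S.card = (S.image fun q : ℕ × ℕ => sc q.1 q.2).card := (Finset.card_image_of_injOn hinj).symm
    have h2 : (S.image fun q : ℕ × ℕ => sc q.1 q.2).card =
        Set.ncard (↑(S.image fun q : ℕ × ℕ => sc q.1 q.2) : Set (WeierstrassCurve ℤ)) :=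
      (Set.ncard_coe_finset _).symm
    have h3 := Set.ncard_le_ncard hsub (windowNoMin_finite _ _ _)
    exact_mod_cast (h1.trans h2).le.trans h3
  -- sizes
  have hScard : (S.card : ℝ) = (primesIoc A B).card * (Ks.card : ℝ) := by
    rw [hSdef, Finset.card_product]; push_cast; ring
  set Np : ℝ := ((primesIoc A B).card : ℝ) with hNpdef
  have hNp0 : 0 ≤ Np := Nat.cast_nonneg _
  have hNp : x / 4 ≤ Np * Lb := hsup
  -- the law at `X`
  have hL := hlaw X hX1
  have hX0 : 0 < X := by linarith
  have hXδ : X ^ δ ≤ 20 * Real.exp (2 * δ * Lb) := by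
    rw [Real.rpow_def_of_pos hX0, hXdef, Real.log_mul (by norm_num) (by positivity), Real.log_pow]
    have h368 : Real.log 368 * δ ≤ Real.log 400 * (1 / 2) := by
      have h1 : Real.log 368 ≤ Real.log 400 := Real.log_le_log (by norm_num) (by norm_num)
      have h2 : 0 ≤ Real.log 368 := Real.log_nonneg (by norm_num)
      have h3 : Real.log 368 * δ ≤ Real.log 368 * (1 / 2) := mul_le_mul_of_nonneg_left hδ2.le h2
      linarith
    have h400 : Real.log 400 * (1 / 2) = Real.log 20 := by
      rw [show (400 : ℝ) = 20 ^ 2 by norm_num, Real.log_pow]; push_cast; ring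
    have : Real.exp ((Real.log 368 + ((2 : ℕ) : ℝ) * Real.log x) * δ) ≤
        Real.exp (Real.log 20 + 2 * δ * Lb) := by
      apply Real.exp_le_exp.mpr
      have hL : Lb = Real.log x := hLbdef
      push_cast
      nlinarith [h368, h400, hL]
    rwa [Real.exp_add, Real.exp_log (by norm_num)] at this
  -- `exp ℓ₂ ≥ x^{2(1-η)/3} / 3`
  have hℓ₂exp : Real.exp (2 * (1 - η) / 3 * Lb) / 3 ≤ Real.exp ℓ₂ := by
    have h110 : Real.log 110592 ≤ 12 * Real.log 3 := by
      have e : Real.log ((3 : ℝ) ^ 12) = 12 * Real.log 3 := by rw [Real.log_pow]; norm_num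
      rw [← e]; exact Real.log_le_log (by norm_num) (by norm_num)
    have h3 : Real.exp (2 * (1 - η) / 3 * Lb) ≤ 3 * Real.exp ℓ₂ := by
      calc Real.exp (2 * (1 - η) / 3 * Lb) ≤ Real.exp (Real.log 3 + ℓ₂) :=
            Real.exp_le_exp.mpr (by rw [hℓ₂def]; linarith)
        _ = 3 * Real.exp ℓ₂ := by rw [Real.exp_add, Real.exp_log (by norm_num)]
    rw [div_le_iff₀ (by norm_num : (0:ℝ) < 3)]; linarith
  -- the main inequality in exponential form
  have hpow : (B : ℝ) ^ (2 * (1 - (7 - κ) / 14) / 3 + 1 - 2 * δ) =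
      Real.exp (2 * (1 - η) / 3 * Lb) * x * Real.exp (-(2 * δ * Lb)) := by
    rw [← hηdef, ← hxdef, Real.rpow_def_of_pos hx0, ← hLbdef]
    rw [show Real.log x * (2 * (1 - η) / 3 + 1 - 2 * δ) = 2 * (1 - η) / 3 * Lb + Lb + -(2 * δ * Lb) by
      rw [hLbdef]; ring, Real.exp_add, Real.exp_add, Real.exp_log hx0]
  rw [hpow] at hmain
  -- combine: `S.card ≥ (x/(4Lb)) · exp ℓ₂ / 2` and `S.card ≤ C · 20 · exp(2δLb)`
  have hE0 : 0 < Real.exp (2 * δ * Lb) := Real.exp_pos _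
  have hEneg : Real.exp (-(2 * δ * Lb)) * Real.exp (2 * δ * Lb) = 1 := by
    rw [← Real.exp_add]; simp
  have h1 : (S.card : ℝ) ≤ C * (20 * Real.exp (2 * δ * Lb)) :=
    (hcount.trans hL).trans (mul_le_mul_of_nonneg_left hXδ hC0.le)
  have h2 : Np * (Real.exp ℓ₂ / 2) ≤ (S.card : ℝ) := by
    rw [hScard]; exact mul_le_mul_of_nonneg_left hKs_card hNp0
  -- `Np · Lb ≥ x/4`, so `x · exp ℓ₂ / 8 ≤ S.card · Lb ≤ 20 C Lb exp(2δLb)`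
  have h3 : x * Real.exp ℓ₂ / 8 ≤ (S.card : ℝ) * Lb := by
    have := mul_le_mul_of_nonneg_right h2 hLb0.le
    have h4 : x / 4 * (Real.exp ℓ₂ / 2) ≤ Np * Lb * (Real.exp ℓ₂ / 2) :=
      mul_le_mul_of_nonneg_right hNp (by positivity)
    linarith
  have h5 : x * Real.exp ℓ₂ / 8 ≤ 20 * C * Lb * Real.exp (2 * δ * Lb) := by
    have := mul_le_mul_of_nonneg_right h1 hLb0.le
    linarith
  -- from `hmain`: `500 C Lb ≤ exp(2(1-η)Lb/3) · x · exp(-2δLb)`; multiply by `exp(2δLb)`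
  have h6 : 500 * C * Lb * Real.exp (2 * δ * Lb) ≤ Real.exp (2 * (1 - η) / 3 * Lb) * x := by
    have := mul_le_mul_of_nonneg_right hmain hE0.le
    rw [mul_assoc (Real.exp (2 * (1 - η) / 3 * Lb) * x), hEneg, mul_one] at this
    exact this
  have h7 : Real.exp (2 * (1 - η) / 3 * Lb) * x ≤ 3 * Real.exp ℓ₂ * x := by
    have := mul_le_mul_of_nonneg_right hℓ₂exp hx0.le
    linarith
  have hpos : 0 < Real.exp ℓ₂ * x := mul_pos (Real.exp_pos _) hx0
  linarith [h5, h6, h7, hpos]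

/-- **Minimality is load-bearing for `ModerateWindowCount`**: with "minimal at every place" dropped the
statement is FALSE (instance `σ = 7`; every `κ ∈ (3,7)`, `δ < (7−κ)/8` refuted by the rescalings
`sc b k` of the prime twists `tw b`). [folklore] -/
theorem moderateWindowCount_false_without_minimality : ¬ ModerateWindowCountWithoutMinimality := by
  intro h
  obtain ⟨κ, δ₀, C₀, hκ3, hκ7, hδ₀, hlaw₀⟩ := h 7 (by norm_num)
  set δ : ℝ := max δ₀ 0 with hδdef
  have hδ0 : 0 ≤ δ := le_max_right _ _
  have hδ : δ < (7 - κ) / 8 := by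
    have e : (7 - κ) / (2 * 7 - 6) = (7 - κ) / 8 := by norm_num
    rw [e] at hδ₀
    exact max_lt hδ₀ (div_pos (by linarith) (by norm_num))
  set C : ℝ := max C₀ 1 with hCdef
  have hC1 : 1 ≤ C := le_max_right _ _
  have hC0 : 0 < C := by linarith
  have hlaw : ∀ X : ℝ, 1 ≤ X → (Set.ncard (windowNoMin κ 7 X) : ℝ) ≤ C * X ^ δ := by
    intro X hX
    refine (hlaw₀ X hX).trans ?_
    have hXδ : X ^ δ₀ ≤ X ^ δ := Real.rpow_le_rpow_of_exponent_le hX (le_max_left _ _)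
    have h0 : 0 ≤ X ^ δ₀ := Real.rpow_nonneg (by linarith) _
    calc C₀ * X ^ δ₀ ≤ C * X ^ δ₀ := mul_le_mul_of_nonneg_right (le_max_left _ _) h0
      _ ≤ C * X ^ δ := mul_le_mul_of_nonneg_left hXδ (by linarith)
  obtain ⟨T₀, hT₀⟩ := primesIoc_card_mul_log_ge
  set η : ℝ := (7 - κ) / 14 with hηdef
  have hη0 : 0 < η := by rw [hηdef]; linarith
  have hη1 : 0 < 1 - η := by rw [hηdef]; linarith
  set e₁ : ℝ := 2 * (1 - (7 - κ) / 14) / 3 + 1 - 2 * δ with he₁def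
  have he₁ : 0 < e₁ := by
    rw [he₁def]
    have : δ < 1 / 2 := by
      have : (7 - κ) / 8 < 1 / 2 := by rw [div_lt_iff₀ (by norm_num)]; linarith
      linarith
    have : 0 < 1 - (7 - κ) / 14 := by linarith
    nlinarith
  have hK : 0 < 500 * C := by positivity
  have hev : ∀ᶠ x : ℝ in Filter.atTop, (T₀ : ℝ) ≤ x ∧ 29 ≤ x ^ (1 - η) ∧ 6 * x ^ (1 - η) + 7 ≤ x ∧
      κ * Real.log 368 + 12 * Real.log 4 ≤ (7 - κ) * Real.log x ∧
      Real.log 110592 ≤ (2 * κ - 6 + 6 * η) * Real.log x ∧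
      500 * C * Real.log x ≤ x ^ e₁ := by
    refine (Filter.eventually_ge_atTop _).and ?_
    refine ((tendsto_rpow_atTop hη1).eventually_ge_atTop 29).and ?_
    refine Filter.Eventually.and ?_ ?_
    · -- `6 x^{1-η} + 7 ≤ x`: from `x^η ≥ 13` and `x = x^{1-η} x^η`
      filter_upwards [(tendsto_rpow_atTop hη0).eventually_ge_atTop 13, Filter.eventually_ge_atTop (1 : ℝ)]
        with x hx hx1
      have hx0 : 0 < x := by linarith
      have h1 : x = x ^ (1 - η) * x ^ η := by rw [← Real.rpow_add hx0]; norm_num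
      have h2 : 1 ≤ x ^ (1 - η) := Real.one_le_rpow hx1 (by linarith)
      have h3 : x ^ (1 - η) * 13 ≤ x ^ (1 - η) * x ^ η := mul_le_mul_of_nonneg_left hx (by linarith)
      linarith
    refine Filter.Eventually.and ?_ ?_
    · exact (Real.tendsto_log_atTop.const_mul_atTop (by linarith : (0:ℝ) < 7 - κ)).eventually_ge_atTop
        (κ * Real.log 368 + 12 * Real.log 4)
    refine Filter.Eventually.and ?_ ?_
    · have h26 : (0:ℝ) < 2 * κ - 6 + 6 * η := by nlinarith
      exact (Real.tendsto_log_atTop.const_mul_atTop h26).eventually_ge_atTop _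
    · refine ((isLittleO_log_rpow_atTop he₁).bound (inv_pos.mpr hK)).mp ?_
      filter_upwards [Filter.eventually_ge_atTop (1 : ℝ)] with x hx h
      rw [Real.norm_eq_abs, Real.norm_eq_abs, abs_of_nonneg (Real.log_nonneg hx),
        abs_of_nonneg (Real.rpow_nonneg (by linarith) _)] at h
      have := mul_le_mul_of_nonneg_left h hK.le
      rwa [← mul_assoc, mul_inv_cancel₀ hK.ne', one_mul] at this
  obtain ⟨x₀, hx₀⟩ := Filter.eventually_atTop.mp hev
  set B : ℕ := ⌈max x₀ 1⌉₊ with hBdef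
  have hBx : x₀ ≤ (B : ℝ) := (le_max_left _ _).trans (Nat.le_ceil _)
  obtain ⟨hBT, h29, hA, hℓ, hℓ₁, hmain⟩ := hx₀ B hBx
  have hBT' : T₀ ≤ B := by exact_mod_cast hBT
  exact noMin_core hκ3 hκ7 hδ hC1 hlaw hT₀ hBT' h29 hA hℓ hℓ₁ hmain

end

end Summit.ABC.ABC.Theorems.ModerateWindowCount.Negative
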